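import Literature.NumberTheory.Automorphic.Liu2021.Def45AsPrinted
import Literature.AlgebraicGeometry.ComplexMultiplication.RationalCMStructureBaseChange
import Literature.AlgebraicGeometry.HodgeTheory.AbelianVarietyCotangentHodgeHolds
import Literature.AlgebraicGeometry.Motives.AbelianVarietyCotangentBaseChangeIso
import Literature.NumberTheory.ComplexMultiplication.CMTypeBasic
import HarnessLib

/-!
# [Liu 2021] Definition 4.5 (2), first bullet ⟺ the CM type of `A_μ ⊗_{E,σ} ℂ` is the induced reflex type `Ψ̃_μ`

Y. Liu, *Fourier–Jacobi cycles and arithmetic relative trace formula*, Camb. J. Math. **9** (2021) = arXiv:2102.11518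
[Liu2021], `FJcycle.tex` §4.1: Def. 4.3 (2) l. 1919 («`M'_μ ⊆ ℂ` the reflex field of `(E, Φ_μ)`, with the induced CM type
`Ψ_μ`»), Remark 4.4 ll. 1930–1933 («`Ψ_{μ^c}` is the opposite CM type of `Ψ_μ`»), Def. 4.5 (1)–(2) ll. 1939–1951, and the
proof of Prop. 4.6 (1), ll. 1975–1982 («By Casselman's theorem [Shi71, Theorem 6] for `(K, Φ) = (M'_μ, Ψ_μ)` … the
determinant of the action of `i'(x')` on the `E'`-vector space `Lie_{E'}(A')` is `η'_μ(x')` for every `x' ∈ M'_μ`», l. 1979).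
G. Shimura, *Abelian Varieties with Complex Multiplication and Modular Functions* (1998) §5.2 (pp. 36–37): for `(A, ι)`
of type `(F; {φ_i})`, «`δι(α)ω_i = α^{φ_i}ω_i`» on the invariant differentials, so that the determinant on `H^{1,0} = Lie^∨`
is the type norm `∏_i α^{φ_i}`; §8.3 Prop. 29 (p. 63): the type norm.

THIS FILE (theorems only; no definition, no instance, no named fact, no `sorry`) is a CONSISTENCY statement about
item6-p1's as-printed typing `Liu2021.Def45.CMDatum.det45` of the FIRST BULLET of Def. 4.5 (2) («for every `x ∈ M_μ`, the
determinant of the action of `i_μ(x)` on the `E`-vector space `Lie_E(A_μ)` equals `η_μ(x)`», l. 1950; typed on the cotangent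
space `𝔪_e/𝔪_e² = Lie_E(A_μ)^∨` over `E`, with `η_μ = Def45.eta` DEFINED as the reflex type norm followed by `Nm_{M_μ/M'_μ}`,
READINGS I1-R2/I1-R4 of `Def45AsPrinted`).  For a CM field `F` Galois over `ℚ` (the cells' `E = F`), an embedding
`σ : F → ℂ` (the pin), `μ` conjugate symplectic with value field `M_μ = muAlgValueField F μ` and CM type `Φ_μ`, an abelian
variety `A / F` and a RATIONAL structure `i : M_μ → End⁰(A)` with `[M_μ : ℚ] = 2 dim A`; write `T ⊆ Hom(M_μ, ℂ)` for the CM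
type READ on `H^{1,0}(A ⊗_{F,σ} ℂ)` for the base-changed structure `i ⊗ ℂ` (tree `hOneEndAction … .cmType = {θ | n_θ = 1}`):

* §1 `apply_det_cotangentMap_eq_pow_mul_finprod_cmType` — the BRIDGE, free of Def. 4.5: for every presentation
  `i(x) = M⁻¹ · (1 ⊗ f)` (`M ≥ 1`, `f ∈ End_F(A)`), `σ(det(f^* | 𝔪_e/𝔪_e²)) = M^{dim A} · ∏_{θ ∈ T} θ(x)`; ingredients
  (tree theorems): `det_cotangentMap_baseChange` (L1b), `det_restrict_hodgeOneZero_eq_det_cotangentMap_holds` (L2,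
  PROVED), `complexAction_baseChange_eq_smul_map`, `det_restrict_complexAction_eq_finprod` (Shimura §5.2).
* §2 `cmType_eq_iff_det_eq` — ABSTRACT EQUIVALENCE: for a CM type `Θ` of `M_μ` and `η' : M_μ → F` with
  `σ(η'(x)) = ∏_{θ ∈ Θ} θ(x)`: `Θ = T` **iff** `∀ x M f, M ≠ 0 → i x = M⁻¹ · (1 ⊗ f) → det(f^*) = M^{dim A} · η'(x)`
  (⟹: a CM type is determined by its type norm, `cmType_eq_of_finprod_eq`, Shimura §8.3 Prop. 29; ⟸: §1, `σ` injective).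
* §3 AT LIU'S `η_μ`: `inducedCMType_eq_cmType_iff_det45` — the typed first bullet (token for token the field
  `Def45.CMDatum.det45`, `η_μ = Def45.eta (AlgHom.id ℚ F) σ hμ`) HOLDS IFF `T` is the induced reflex type
  `Ψ̃_μ = inducedCMType e (reflexCMType σ Φ_μ id)` (`e : M'_μ → M_μ` THE inclusion, `(e k : ℂ) = σ k`).  ⟹
  (`inducedCMType_eq_cmType_of_det45`) is isog-2's `Model.exists_isogeny_isCMTypeRealisation_baseChange_of_det45`
  (p301919) before its isogeny / principalisation tail; ⟸ (`det45_of_inducedCMType_eq_cmType`) is NEW in the tree —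
  [Liu2021] l. 1979 / Shimura §5.2 in the kernel: ANY `(A, i)` whose complex fibre along `σ` has CM type `Ψ̃_μ`
  satisfies the first bullet AS TYPED.
* §4 THE CONJUGATE CONVENTION `η̄_μ := c ∘ η_μ` (`c = complexConj F`) IS A DIFFERENT, INCOMPATIBLE CONDITION:
  `bar_inducedCMType_eq_cmType_iff_det45_complexConj` — the identity with `η̄_μ` holds iff `T` is the CONJUGATE type
  `bar Ψ̃_μ` (the type of `μ^c`, Remark 4.4); `not_det45_complexConj_of_det45` — no `(A, i)` satisfies both.  (The
  tree's `Def45EtaConjugate` shows separately that `η_μ` does not change under `ι ↦ conj ∘ ι`.)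
* §5 per object `X : Def45.CMDatum (AlgHom.id ℚ F) σ hμ hw C`: `CMDatum.inducedCMType_eq_cmType`,
  `CMDatum.inducedCMType_incl_eq_cmType` (the CM type of `X.A ⊗_{F,σ} ℂ` IS `Ψ̃_μ`), `CMDatum.not_det45_complexConj`.

WHAT THIS ANSWERS (red team TGTBT.md D10.3/D11.3 item 5, «η-convention»): inside the tree the typed first bullet
carries NO convention beyond READING I1-R2 (`η'_μ` = the reflex type norm, the paper's own reading at l. 1979):
it is EQUIVALENT to «`A_μ ⊗_{E,σ} ℂ` has CM type `Ψ̃_μ`» (Liu's Def. 4.3 (2) type induced to `M_μ`) at every pin `σ`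
(the bullet is an identity in `E`), and the conjugate convention is refuted at every datum satisfying it.
Nothing here asserts that Liu's `A_μ` exists ([Liu2021] Prop. 4.6 (1)) or that HC_CM holds.

## References
* [Liu2021] Y. Liu, Camb. J. Math. 9 (2021) = arXiv:2102.11518 — Def. 4.3 (2) (l. 1919), Rem. 4.4 (ll. 1930–1933), Def. 4.5
  (ll. 1936–1964), proof of Prop. 4.6 (1) (ll. 1975–1982, esp. l. 1979).
* [Shimura1998] G. Shimura, *Abelian Varieties with Complex Multiplication and Modular Functions* (1998), §5.2 (pp. 36–37),
  §8.3 Prop. 29 (p. 63), §18.5 (18.5b).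
* [LangeBirkenhake1992] H. Lange, Ch. Birkenhake, *Complex Abelian Varieties* (1992), §1.1.2 Cor. 1.1.7, §1.1.5 (1.6).
* [GortzWedhorn2020] U. Görtz, T. Wedhorn, *Algebraic Geometry I* (2020), (6.6.2)–(6.6.3), Remark 6.12.
* [MumfordAV1970] D. Mumford, *Abelian Varieties* (1970), §19.
-/

set_option autoImplicit false

noncomputable section

open scoped TensorProduct
open CategoryTheory NumberField NumberField.ComplexEmbedding
open Literature.AlgebraicGeometry.Motives Literature.AlgebraicGeometry.HodgeTheory
open Literature.AlgebraicGeometry.ComplexMultiplication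
open Literature.NumberTheory.ComplexMultiplication
open Literature.NumberTheory.ComplexMultiplication.CMTypeOps (bar mem_bar_iff conjugate_mem_iff_notMem)

namespace Literature.NumberTheory.Automorphic.Liu2021.Def45

variable {F : Type} [Field F] [NumberField F] [IsCMField F] [IsGalois ℚ F] (σ : F →+* ℂ)
  {μ : IdeleClassGroup F →ₜ* Circle} (hμ : IdeleClassGroup.IsConjugateSymplectic F μ)
  (A : AbelianVariety F) (i : IdeleClassGroup.muAlgValueField F μ →+* A.endAlgebra)
  (hdim : Module.finrank ℚ (IdeleClassGroup.muAlgValueField F μ) = 2 * A.dim)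

/-! ## §1 The bridge: the `F`-rational cotangent determinant read in `ℂ` is the type norm of the CM type read on
`H^{1,0}(A ⊗_{F,σ} ℂ)`, for every presentation `i(x) = M⁻¹ · (1 ⊗ f)` -/

omit [IsGalois ℚ F] in
include hdim in
/-- **BRIDGE (free of Def. 4.5).**  For `A / F`, the pin `σ : F → ℂ`, a rational structure `i : M_μ → End⁰(A)` of full
degree `[M_μ:ℚ] = 2 dim A`, and every presentation `i(x) = M⁻¹ · (1 ⊗ f)` (`M ≠ 0`, `f ∈ End_F(A)`):
`σ(det(f^* | 𝔪_e/𝔪_e²)) = M^{dim A} · ∏_{θ ∈ T} θ(x)`, `T` the CM type read on `H^{1,0}(A ⊗_{F,σ} ℂ)` for `i ⊗ ℂ`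
(`hOneEndAction … .cmType = {θ | n_θ = 1}`).  Proof: `σ(det f^*) = det (f_ℂ)^* = det (f_ℂ^* | H^{1,0}(A_ℂ))`
(`det_cotangentMap_baseChange`, `det_restrict_hodgeOneZero_eq_det_cotangentMap_holds`); `(i ⊗ ℂ)(x) = M⁻¹ · f_ℂ^*` on
`H¹(A_ℂ(ℂ); ℂ)` (`complexAction_baseChange_eq_smul_map`), `det ((i ⊗ ℂ)(x) | H^{1,0}) = ∏_{θ ∈ T} θ(x)`
(`det_restrict_complexAction_eq_finprod`, Shimura §5.2), `dim H^{1,0} = dim A`.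
[cite: Shimura1998, §5.2 (pp. 36–37)] [cite: LangeBirkenhake1992, §1.1.2 Corollary 1.1.7 and §1.1.5 (1.6)]
[cite: GortzWedhorn2020, (6.6.2)–(6.6.3) and Remark 6.12] [cite: MumfordAV1970, §19] -/
theorem apply_det_cotangentMap_eq_pow_mul_finprod_cmType (x : IdeleClassGroup.muAlgValueField F μ) (M : ℕ)
    (f : End A) (hM : M ≠ 0)
    (h : i x = algebraMap ℚ A.endAlgebra (M : ℚ)⁻¹ * AbelianVariety.endAlgebra.of A f) :
    haveI := hμ.numberField_muAlgValueField
    letI := σ.toAlgebra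
    σ (LinearMap.det (AbelianVariety.cotangentMap A f)) =
      (M : ℂ) ^ A.dim *
        ∏ᶠ θ ∈ (hOneEndAction ((AbelianVariety.endAlgebraBaseChange ℂ A).toRingHom.comp i)
          exists_isReal_hodgeModel_holds hodgePQ_independent_of_hodgeModel_holds).cmType, θ x := by
  haveI := hμ.numberField_muAlgValueField
  letI := σ.toAlgebra
  have hXℂ := AbelianVariety.isSmoothProjective_holds (A := A.baseChange ℂ)
  have hW : ∀ v, v ∈ hodgeOneZero hXℂ ↔ IsOfHodgeType (A.baseChange ℂ).dim (A.baseChange ℂ).X 1 1 0 v :=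
    fun _ => Iff.rfl
  have hst : ∀ v ∈ hodgeOneZero hXℂ,
      complexAction ((AbelianVariety.endAlgebraBaseChange ℂ A).toRingHom.comp i) x v ∈ hodgeOneZero hXℂ := fun _ hv =>
    complexAction_mem_of_mem_iff exists_isReal_hodgeModel_holds hodgePQ_independent_of_hodgeModel_holds _ _ hW x hv
  have hdimℂ : Module.finrank ℚ (IdeleClassGroup.muAlgValueField F μ) = 2 * (A.baseChange ℂ).dim := by
    rw [AbelianVariety.dim_baseChange]; exact hdim
  have hT := det_restrict_complexAction_eq_finprod exists_isReal_hodgeModel_holds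
    hodgePQ_independent_of_hodgeModel_holds _ hdimℂ (hodgeOneZero hXℂ) hW x hst
  have hact := complexAction_baseChange_eq_smul_map i h
  have hres : (complexAction ((AbelianVariety.endAlgebraBaseChange ℂ A).toRingHom.comp i) x).restrict hst =
      (((M : ℚ)⁻¹ : ℚ) : ℂ) • ((complexBetti.map (AbelianVariety.Hom.baseChange ℂ f).hom.hom.hom 1).hom).restrict
        (fun _ hv => map_mem_hodgeOneZero hXℂ (AbelianVariety.Hom.baseChange ℂ f).hom.hom.hom hv) := by
    refine LinearMap.ext fun v => Subtype.ext ?_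
    rw [LinearMap.coe_restrict_apply, hact, LinearMap.smul_apply, LinearMap.smul_apply, Submodule.coe_smul,
      LinearMap.coe_restrict_apply]
  rw [hres, LinearMap.det_smul, AbelianVariety.finrank_hodgeOneZero_eq_dim (A.baseChange ℂ) hXℂ,
    det_restrict_hodgeOneZero_eq_det_cotangentMap_holds (A.baseChange ℂ) (AbelianVariety.Hom.baseChange ℂ f),
    AbelianVariety.det_cotangentMap_baseChange ℂ f, RingHom.algebraMap_toAlgebra,
    show (((M : ℚ)⁻¹ : ℚ) : ℂ) ^ (A.baseChange ℂ).dim = (((M : ℚ)⁻¹ : ℚ) : ℂ) ^ A.dim by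
      rw [AbelianVariety.dim_baseChange]] at hT
  -- `M^{dim A} · (M⁻¹)^{dim A} · σ(det f^*) = M^{dim A} · ∏ θ(x)`
  rw [← hT, Rat.cast_inv, Rat.cast_natCast, ← mul_assoc, ← mul_pow, mul_inv_cancel₀ (Nat.cast_ne_zero.2 hM : (M : ℂ) ≠ 0),
    one_pow, one_mul]

/-! ## §2 Abstract equivalence: a CM type with type norm `σ ∘ η'` is the type read on `H^{1,0}` iff the determinant
identity with `η'` holds -/

section Abstract

variable (Θ : CMType (IdeleClassGroup.muAlgValueField F μ)) (η' : IdeleClassGroup.muAlgValueField F μ → F)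
  (hη' : ∀ x, σ (η' x) = ∏ᶠ θ ∈ Θ.1, θ x)

omit [IsGalois ℚ F] in
include hdim hη' in
/-- **Determinant identity ⟹ type.**  If `σ(η'(x)) = ∏_{θ ∈ Θ} θ(x)` for a CM type `Θ` of `M_μ` and
`det(f^* | 𝔪_e/𝔪_e²) = M^{dim A} · η'(x)` for every presentation `i(x) = M⁻¹ · (1 ⊗ f)`, then `Θ` IS the CM type read on
`H^{1,0}(A ⊗_{F,σ} ℂ)` (§1: equal type norms on `M_μ^×`; a CM type is determined by its type norm, `cmType_eq_of_finprod_eq`).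
[cite: Shimura1998, §5.2 (pp. 36–37) and §8.3 Proposition 29 (p. 63)] -/
theorem cmType_eq_of_det_eq
    (hdet : ∀ (x : IdeleClassGroup.muAlgValueField F μ) (M : ℕ) (f : End A), M ≠ 0 →
      i x = algebraMap ℚ A.endAlgebra (M : ℚ)⁻¹ * AbelianVariety.endAlgebra.of A f →
        LinearMap.det (AbelianVariety.cotangentMap A f) = (M : F) ^ A.dim * η' x) :
    haveI := hμ.numberField_muAlgValueField
    letI := σ.toAlgebra
    Θ.1 = (hOneEndAction ((AbelianVariety.endAlgebraBaseChange ℂ A).toRingHom.comp i)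
        exists_isReal_hodgeModel_holds hodgePQ_independent_of_hodgeModel_holds).cmType := by
  haveI := hμ.numberField_muAlgValueField
  letI := σ.toAlgebra
  refine cmType_eq_of_finprod_eq exists_isReal_hodgeModel_holds hodgePQ_independent_of_hodgeModel_holds _ _
    fun x _ => ?_
  obtain ⟨M, f, hM, hxf⟩ := AbelianVariety.endAlgebra.exists_eq_algebraMap_mul_of (i x)
  have hbridge := apply_det_cotangentMap_eq_pow_mul_finprod_cmType σ hμ A i hdim x M f hM hxf
  rw [hdet x M f hM hxf, map_mul, map_pow, map_natCast, hη'] at hbridge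
  have hM' : (M : ℂ) ^ A.dim ≠ 0 := pow_ne_zero _ (Nat.cast_ne_zero.2 hM)
  exact (mul_left_cancel₀ hM' hbridge).symm

omit [IsGalois ℚ F] in
include hdim hη' in
/-- **Type ⟹ determinant identity.**  If `σ(η'(x)) = ∏_{θ ∈ Θ} θ(x)` and `Θ` is the CM type read on
`H^{1,0}(A ⊗_{F,σ} ℂ)`, then `det(f^* | 𝔪_e/𝔪_e²) = M^{dim A} · η'(x)` in `F` for EVERY presentation `i(x) = M⁻¹ · (1 ⊗ f)`
(§1 and injectivity of `σ`; Shimura §5.2 «`δι(α)ω_i = α^{φ_i}ω_i`»). [cite: Shimura1998, §5.2 (pp. 36–37)] -/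
theorem det_eq_of_cmType_eq
    (hΘ : haveI := hμ.numberField_muAlgValueField
      letI := σ.toAlgebra
      Θ.1 = (hOneEndAction ((AbelianVariety.endAlgebraBaseChange ℂ A).toRingHom.comp i)
        exists_isReal_hodgeModel_holds hodgePQ_independent_of_hodgeModel_holds).cmType)
    (x : IdeleClassGroup.muAlgValueField F μ) (M : ℕ) (f : End A) (hM : M ≠ 0)
    (h : i x = algebraMap ℚ A.endAlgebra (M : ℚ)⁻¹ * AbelianVariety.endAlgebra.of A f) :
    LinearMap.det (AbelianVariety.cotangentMap A f) = (M : F) ^ A.dim * η' x := by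
  haveI := hμ.numberField_muAlgValueField
  refine σ.injective ?_
  rw [apply_det_cotangentMap_eq_pow_mul_finprod_cmType σ hμ A i hdim x M f hM h, map_mul, map_pow, map_natCast,
    hη', hΘ]

omit [IsGalois ℚ F] in
include hdim hη' in
/-- **ABSTRACT EQUIVALENCE.**  For a CM type `Θ` of `M_μ` and `η' : M_μ → F` with `σ(η'(x)) = ∏_{θ ∈ Θ} θ(x)`:
`Θ` is the CM type read on `H^{1,0}(A ⊗_{F,σ} ℂ)` for `i ⊗ ℂ` **iff** `det(f^* | 𝔪_e/𝔪_e²) = M^{dim A} · η'(x)` for every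
presentation `i(x) = M⁻¹ · (1 ⊗ f)`. [cite: Shimura1998, §5.2 (pp. 36–37) and §8.3 Proposition 29 (p. 63)] -/
theorem cmType_eq_iff_det_eq :
    haveI := hμ.numberField_muAlgValueField
    letI := σ.toAlgebra
    Θ.1 = (hOneEndAction ((AbelianVariety.endAlgebraBaseChange ℂ A).toRingHom.comp i)
          exists_isReal_hodgeModel_holds hodgePQ_independent_of_hodgeModel_holds).cmType ↔
      ∀ (x : IdeleClassGroup.muAlgValueField F μ) (M : ℕ) (f : End A), M ≠ 0 →
        i x = algebraMap ℚ A.endAlgebra (M : ℚ)⁻¹ * AbelianVariety.endAlgebra.of A f →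
          LinearMap.det (AbelianVariety.cotangentMap A f) = (M : F) ^ A.dim * η' x :=
  ⟨fun hΘ x M f hM h => det_eq_of_cmType_eq σ hμ A i hdim Θ η' hη' hΘ x M f hM h,
    fun hdet => cmType_eq_of_det_eq σ hμ A i hdim Θ η' hη' hdet⟩

end Abstract

/-! ## §3 At Liu's `η_μ`: first bullet of Def. 4.5 (2) AS TYPED ⟺ the CM type of `A ⊗_{F,σ} ℂ` is `Ψ̃_μ` -/

section Liu

variable (e : reflexField ℚ F (algValuedIn σ hμ.cmType.1) →+* IdeleClassGroup.muAlgValueField F μ)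
  (he : ∀ k, ((e k : IdeleClassGroup.muAlgValueField F μ) : ℂ) = σ k)

include he in
/-- `σ(η_μ(x)) = ∏_{θ ∈ Ψ̃_μ} θ(x)` with `AlgHom.id` unfolded (sub-object (N), `apply_eta_eq_finprod_of_coe_eq`).
[cite: Liu2021, Def. 4.5 (1) (l. 1941)] -/
theorem apply_eta_id_eq_finprod (x : IdeleClassGroup.muAlgValueField F μ) :
    σ (eta (AlgHom.id ℚ F) σ hμ x) = ∏ᶠ θ ∈ (inducedCMType e (reflexCMType σ hμ.cmType (AlgHom.id ℚ F))).1, θ x := by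
  have hη := apply_eta_eq_finprod_of_coe_eq (AlgHom.id ℚ F) σ hμ e he x
  rwa [AlgHom.id_apply] at hη

include hdim he in
/-- **[Liu2021, Def. 4.5 (2)] first bullet ⟹ the CM type of `A_μ ⊗_{E,σ} ℂ` is `Ψ̃_μ`** (no isogeny tail): if
`det(f^* | 𝔪_e/𝔪_e²) = M^{dim A} · η_μ(x)` for every presentation `i(x) = M⁻¹ · (1 ⊗ f)` (`η_μ = Def45.eta id σ Φ_μ`, l. 1941),
then the CM type read on `H^{1,0}(A ⊗_{F,σ} ℂ)` for `i ⊗ ℂ` IS `Ψ̃_μ = inducedCMType e (reflexCMType σ Φ_μ id)` for THE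
inclusion `e : M'_μ → M_μ` (`(e k : ℂ) = σ k`, §4.1 l. 1928). [cite: Liu2021, Def. 4.5 (1)–(2) (FJcycle.tex ll. 1939–1951) and Def. 4.3 (2) (l. 1919)]
[cite: Shimura1998, §5.2 (pp. 36–37) and §8.3 Proposition 29 (p. 63)] -/
theorem inducedCMType_eq_cmType_of_det45
    (hdet45 : ∀ (x : IdeleClassGroup.muAlgValueField F μ) (M : ℕ) (f : End A), M ≠ 0 →
      i x = algebraMap ℚ A.endAlgebra (M : ℚ)⁻¹ * AbelianVariety.endAlgebra.of A f →
        LinearMap.det (AbelianVariety.cotangentMap A f) = (M : F) ^ A.dim * eta (AlgHom.id ℚ F) σ hμ x) :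
    haveI := hμ.numberField_muAlgValueField
    letI := σ.toAlgebra
    (inducedCMType e (reflexCMType σ hμ.cmType (AlgHom.id ℚ F))).1 =
      (hOneEndAction ((AbelianVariety.endAlgebraBaseChange ℂ A).toRingHom.comp i)
        exists_isReal_hodgeModel_holds hodgePQ_independent_of_hodgeModel_holds).cmType :=
  cmType_eq_of_det_eq σ hμ A i hdim _ _ (apply_eta_id_eq_finprod σ hμ e he) hdet45

include hdim he in
/-- **The CM type of `A ⊗_{F,σ} ℂ` is `Ψ̃_μ` ⟹ [Liu2021, Def. 4.5 (2)] first bullet AS TYPED** — NEW direction, Liu's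
l. 1979 («for `(K, Φ) = (M'_μ, Ψ_μ)` … the determinant of the action of `i'(x')` on `Lie_{E'}(A')` is `η'_μ(x')`») and
Shimura §5.2 («`δι(α)ω_i = α^{φ_i}ω_i`») in the kernel: if the CM type read on `H^{1,0}(A ⊗_{F,σ} ℂ)` for `i ⊗ ℂ` is
`Ψ̃_μ`, then `det(f^* | 𝔪_e/𝔪_e²) = M^{dim A} · η_μ(x)` in `F` for EVERY presentation `i(x) = M⁻¹ · (1 ⊗ f)` (`η_μ = Def45.eta
id σ Φ_μ` — the typed convention, not its conjugate). [cite: Liu2021, Def. 4.5 (1)–(2) (FJcycle.tex ll. 1939–1951) and proof of Prop. 4.6 (1) (l. 1979)]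
[cite: Shimura1998, §5.2 (pp. 36–37)] -/
theorem det45_of_inducedCMType_eq_cmType
    (hΨ : haveI := hμ.numberField_muAlgValueField
      letI := σ.toAlgebra
      (inducedCMType e (reflexCMType σ hμ.cmType (AlgHom.id ℚ F))).1 =
        (hOneEndAction ((AbelianVariety.endAlgebraBaseChange ℂ A).toRingHom.comp i)
          exists_isReal_hodgeModel_holds hodgePQ_independent_of_hodgeModel_holds).cmType)
    (x : IdeleClassGroup.muAlgValueField F μ) (M : ℕ) (f : End A) (hM : M ≠ 0)
    (h : i x = algebraMap ℚ A.endAlgebra (M : ℚ)⁻¹ * AbelianVariety.endAlgebra.of A f) :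
    LinearMap.det (AbelianVariety.cotangentMap A f) = (M : F) ^ A.dim * eta (AlgHom.id ℚ F) σ hμ x :=
  det_eq_of_cmType_eq σ hμ A i hdim _ _ (apply_eta_id_eq_finprod σ hμ e he) hΨ x M f hM h

include hdim he in
/-- **THE EQUIVALENCE.**  For `(A / F, i : M_μ → End⁰(A))` of full degree and the pin `σ`: the CM type read on
`H^{1,0}(A ⊗_{F,σ} ℂ)` for `i ⊗ ℂ` is `Ψ̃_μ = inducedCMType e (reflexCMType σ Φ_μ id)` **if and only if** the FIRST BULLET
of [Liu2021] Def. 4.5 (2) holds AS TYPED (`Def45.CMDatum.det45`, `η_μ = Def45.eta id σ Φ_μ`).  The typed bullet is thus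
EXACTLY «`A_μ ⊗_{E,σ} ℂ` has CM type `Ψ̃_μ`» (Liu Def. 4.3 (2), induced to `M_μ`), for every pin `σ`.
[cite: Liu2021, Def. 4.3 (2) (l. 1919), Def. 4.5 (1)–(2) (ll. 1939–1951) and proof of Prop. 4.6 (1) (l. 1979)]
[cite: Shimura1998, §5.2 (pp. 36–37) and §8.3 Proposition 29 (p. 63)] -/
theorem inducedCMType_eq_cmType_iff_det45 :
    haveI := hμ.numberField_muAlgValueField
    letI := σ.toAlgebra
    (inducedCMType e (reflexCMType σ hμ.cmType (AlgHom.id ℚ F))).1 =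
        (hOneEndAction ((AbelianVariety.endAlgebraBaseChange ℂ A).toRingHom.comp i)
          exists_isReal_hodgeModel_holds hodgePQ_independent_of_hodgeModel_holds).cmType ↔
      ∀ (x : IdeleClassGroup.muAlgValueField F μ) (M : ℕ) (f : End A), M ≠ 0 →
        i x = algebraMap ℚ A.endAlgebra (M : ℚ)⁻¹ * AbelianVariety.endAlgebra.of A f →
          LinearMap.det (AbelianVariety.cotangentMap A f) = (M : F) ^ A.dim * eta (AlgHom.id ℚ F) σ hμ x :=
  cmType_eq_iff_det_eq σ hμ A i hdim _ _ (apply_eta_id_eq_finprod σ hμ e he)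

end Liu

/-! ## §4 The conjugate convention `η̄_μ = c ∘ η_μ` is equivalent to the CONJUGATE type, hence incompatible -/

section Conjugate

omit [IsCMField F] [IsGalois ℚ F] in
/-- The type norm of the conjugate type `Θ̄ = Θᶜ` is the complex conjugate of the type norm of `Θ`. [folklore] -/
private theorem finprod_mem_bar_eq_conj {M : Type} [Field M] [NumberField M] (Θ : CMType M) (x : M) :
    ∏ᶠ θ ∈ (bar Θ).1, θ x = starRingEnd ℂ (∏ᶠ θ ∈ Θ.1, θ x) := by
  -- adapted from the private `finprod_mem_bar_apply` of `Liu2021/Def45EtaConjugate`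
  have himg : (bar Θ).1 = conjugate '' Θ.1 := by
    ext θ
    rw [mem_bar_iff, Set.mem_image]
    constructor
    · intro h
      exact ⟨conjugate θ, (conjugate_mem_iff_notMem Θ θ).mpr h, involutive_conjugate M θ⟩
    · rintro ⟨θ', hθ', rfl⟩
      exact (Θ.2 θ').mp hθ'
  have hmap := MonoidHom.map_finprod_mem (fun θ : M →+* ℂ => θ x) (starRingEnd ℂ : ℂ →* ℂ) (Set.toFinite Θ.1)
  simp only [MonoidHom.coe_coe] at hmap
  rw [himg, finprod_mem_image (involutive_conjugate M).injective.injOn]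
  calc ∏ᶠ θ ∈ Θ.1, (conjugate θ) x = ∏ᶠ θ ∈ Θ.1, starRingEnd ℂ (θ x) :=
        finprod_mem_congr rfl fun θ _ => conjugate_coe_eq θ x
    _ = starRingEnd ℂ (∏ᶠ θ ∈ Θ.1, θ x) := hmap.symm

variable (e : reflexField ℚ F (algValuedIn σ hμ.cmType.1) →+* IdeleClassGroup.muAlgValueField F μ)
  (he : ∀ k, ((e k : IdeleClassGroup.muAlgValueField F μ) : ℂ) = σ k)

include he in
/-- `σ(c(η_μ(x))) = ∏_{θ ∈ bar Ψ̃_μ} θ(x)`: the conjugate convention `η̄_μ = c ∘ η_μ` (`c = complexConj F`, `σ ∘ c = conj ∘ σ`)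
reads through `σ` as the type norm of the CONJUGATE type. [cite: Liu2021, Remark 4.4 (ll. 1930–1933) and Def. 4.5 (1) (l. 1941)] -/
theorem apply_complexConj_eta_eq_finprod_bar (x : IdeleClassGroup.muAlgValueField F μ) :
    haveI := hμ.numberField_muAlgValueField
    σ (IsCMField.complexConj F (eta (AlgHom.id ℚ F) σ hμ x)) =
      ∏ᶠ θ ∈ (bar (inducedCMType e (reflexCMType σ hμ.cmType (AlgHom.id ℚ F)))).1, θ x := by
  haveI := hμ.numberField_muAlgValueField
  rw [IsCMField.complexEmbedding_complexConj, finprod_mem_bar_eq_conj, apply_eta_id_eq_finprod σ hμ e he]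

include hdim he in
/-- **The conjugate convention is equivalent to the conjugate type**: the determinant identity with
`η̄_μ = c ∘ η_μ` in place of `η_μ` holds for every presentation `i(x) = M⁻¹ · (1 ⊗ f)` **iff** the CM type read on
`H^{1,0}(A ⊗_{F,σ} ℂ)` is `bar Ψ̃_μ` (the type of `μ^c`, [Liu2021] Remark 4.4) — NOT Liu's `Ψ̃_μ`.
[cite: Liu2021, Remark 4.4 (ll. 1930–1933) and Def. 4.5 (2) (l. 1950)] [cite: Shimura1998, §5.2 (pp. 36–37) and §8.3 Proposition 29 (p. 63)] -/
theorem bar_inducedCMType_eq_cmType_iff_det45_complexConj :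
    haveI := hμ.numberField_muAlgValueField
    letI := σ.toAlgebra
    (bar (inducedCMType e (reflexCMType σ hμ.cmType (AlgHom.id ℚ F)))).1 =
        (hOneEndAction ((AbelianVariety.endAlgebraBaseChange ℂ A).toRingHom.comp i)
          exists_isReal_hodgeModel_holds hodgePQ_independent_of_hodgeModel_holds).cmType ↔
      ∀ (x : IdeleClassGroup.muAlgValueField F μ) (M : ℕ) (f : End A), M ≠ 0 →
        i x = algebraMap ℚ A.endAlgebra (M : ℚ)⁻¹ * AbelianVariety.endAlgebra.of A f →
          LinearMap.det (AbelianVariety.cotangentMap A f) =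
            (M : F) ^ A.dim * IsCMField.complexConj F (eta (AlgHom.id ℚ F) σ hμ x) := by
  haveI := hμ.numberField_muAlgValueField
  exact cmType_eq_iff_det_eq σ hμ A i hdim _ (fun x => IsCMField.complexConj F (eta (AlgHom.id ℚ F) σ hμ x))
    (apply_complexConj_eta_eq_finprod_bar σ hμ e he)

include hdim in
/-- **No `(A, i)` satisfies the first bullet under BOTH conventions**: if `det(f^*) = M^{dim A} · η_μ(x)` for every
presentation (the typed bullet), the identity with `η̄_μ = c ∘ η_μ` FAILS for some presentation (else the CM type read on
`H^{1,0}(A ⊗_{F,σ} ℂ)` would be both `Ψ̃_μ` and `bar Ψ̃_μ = Ψ̃_μᶜ`). [cite: Liu2021, Remark 4.4 (ll. 1930–1933) and Def. 4.5 (2) (l. 1950)] -/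
theorem not_det45_complexConj_of_det45
    (hdet45 : ∀ (x : IdeleClassGroup.muAlgValueField F μ) (M : ℕ) (f : End A), M ≠ 0 →
      i x = algebraMap ℚ A.endAlgebra (M : ℚ)⁻¹ * AbelianVariety.endAlgebra.of A f →
        LinearMap.det (AbelianVariety.cotangentMap A f) = (M : F) ^ A.dim * eta (AlgHom.id ℚ F) σ hμ x) :
    ¬ ∀ (x : IdeleClassGroup.muAlgValueField F μ) (M : ℕ) (f : End A), M ≠ 0 →
        i x = algebraMap ℚ A.endAlgebra (M : ℚ)⁻¹ * AbelianVariety.endAlgebra.of A f →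
          LinearMap.det (AbelianVariety.cotangentMap A f) =
            (M : F) ^ A.dim * IsCMField.complexConj F (eta (AlgHom.id ℚ F) σ hμ x) := by
  haveI := hμ.numberField_muAlgValueField
  intro hbar
  have h₁ := inducedCMType_eq_cmType_of_det45 σ hμ A i hdim (incl (AlgHom.id ℚ F) σ hμ)
    (coe_incl (AlgHom.id ℚ F) σ hμ) hdet45
  have h₂ := (bar_inducedCMType_eq_cmType_iff_det45_complexConj σ hμ A i hdim (incl (AlgHom.id ℚ F) σ hμ)
    (coe_incl (AlgHom.id ℚ F) σ hμ)).2 hbar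
  -- `Ψ̃_μ = T = Ψ̃_μᶜ` is absurd: test at the tautological embedding `M_μ ⊆ ℂ`
  have hmem := Set.ext_iff.1 (h₁.trans h₂.symm) (IdeleClassGroup.muAlgValueField F μ).subtype
  rw [mem_bar_iff] at hmem
  exact iff_not_self hmem

end Conjugate

/-! ## §5 Per object of the as-printed typing `Def45.CMDatum` -/

namespace CMDatum

variable {σ hμ} {hw : IdeleClassGroup.HasWeight F μ 1} {C : Carriers F μ} (X : CMDatum (AlgHom.id ℚ F) σ hμ hw C)

/-- **For a CM datum `D_μ = (A_μ, i_μ, λ_μ, r_μ)` of [Liu2021] Def. 4.5 (2) (as typed, presentation `(F, id, σ)`), the CM type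
of `A_μ ⊗_{E,σ} ℂ` read on `H^{1,0}` for `i_μ ⊗ ℂ` IS `Ψ̃_μ = inducedCMType e (reflexCMType σ Φ_μ id)`** (any inclusion `e`
over `ℂ`) — from `X.finrank_eq` (l. 1948) and `X.det45` (l. 1950); the ⟨CARRIER⟩ fields are not used.
[cite: Liu2021, Def. 4.3 (2) (l. 1919) and Def. 4.5 (2) (ll. 1944–1951)] [cite: Shimura1998, §5.2 (pp. 36–37)] -/
theorem inducedCMType_eq_cmType
    (e : reflexField ℚ F (algValuedIn σ hμ.cmType.1) →+* IdeleClassGroup.muAlgValueField F μ)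
    (he : ∀ k, ((e k : IdeleClassGroup.muAlgValueField F μ) : ℂ) = σ k) :
    haveI := hμ.numberField_muAlgValueField
    letI := σ.toAlgebra
    (inducedCMType e (reflexCMType σ hμ.cmType (AlgHom.id ℚ F))).1 =
      (hOneEndAction ((AbelianVariety.endAlgebraBaseChange ℂ X.A).toRingHom.comp X.i)
        exists_isReal_hodgeModel_holds hodgePQ_independent_of_hodgeModel_holds).cmType :=
  inducedCMType_eq_cmType_of_det45 σ hμ X.A X.i X.finrank_eq e he X.det45

/-- The same at the CANONICAL inclusion `Def45.incl : M'_μ → M_μ` (`(incl k : ℂ) = σ k`): the CM type of `A_μ ⊗_{E,σ} ℂ`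
for `i_μ ⊗ ℂ` is `inducedCMType incl (reflexCMType σ Φ_μ id)` — the type whose type norm is `σ ∘ η_μ`
(`Def45.apply_eta_eq_finprod`). [cite: Liu2021, Def. 4.3 (2) (l. 1919), §4.1 l. 1928 and Def. 4.5 (2) (l. 1950)]
[cite: Shimura1998, §5.2 (pp. 36–37)] -/
theorem inducedCMType_incl_eq_cmType :
    haveI := hμ.numberField_muAlgValueField
    letI := σ.toAlgebra
    (inducedCMType (incl (AlgHom.id ℚ F) σ hμ) (reflexCMType σ hμ.cmType (AlgHom.id ℚ F))).1 =
      (hOneEndAction ((AbelianVariety.endAlgebraBaseChange ℂ X.A).toRingHom.comp X.i)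
        exists_isReal_hodgeModel_holds hodgePQ_independent_of_hodgeModel_holds).cmType :=
  X.inducedCMType_eq_cmType (incl (AlgHom.id ℚ F) σ hμ) (coe_incl (AlgHom.id ℚ F) σ hμ)

/-- **Every CM datum of the as-printed typing VIOLATES the conjugate convention**: for `X : Def45.CMDatum …` there is a
presentation `i_μ(x) = M⁻¹ · (1 ⊗ f)` with `det(f^* | 𝔪_e/𝔪_e²) ≠ M^{dim A_μ} · c(η_μ(x))` (`c = complexConj F`).
[cite: Liu2021, Remark 4.4 (ll. 1930–1933) and Def. 4.5 (2) (l. 1950)] -/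
theorem not_det45_complexConj :
    ¬ ∀ (x : IdeleClassGroup.muAlgValueField F μ) (M : ℕ) (f : End X.A), M ≠ 0 →
        X.i x = algebraMap ℚ X.A.endAlgebra (M : ℚ)⁻¹ * AbelianVariety.endAlgebra.of X.A f →
          LinearMap.det (AbelianVariety.cotangentMap X.A f) =
            (M : F) ^ X.A.dim * IsCMField.complexConj F (eta (AlgHom.id ℚ F) σ hμ x) :=
  not_det45_complexConj_of_det45 σ hμ X.A X.i X.finrank_eq X.det45

end CMDatum

end Literature.NumberTheory.Automorphic.Liu2021.Def45

end
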